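import Summits.HodgeConjecture.HodgeConjecture.Theorems.Ring2WeilCoverageNormCriteria
import Summits.HodgeConjecture.HodgeConjecture.Theorems.Ring2WeilNormObstructionDescentCensus
import Summits.HodgeConjecture.HodgeConjecture.Theorems.Ring2AbelianAllNonsplitNormObstruction
import HarnessLib

/-!
# Weil-type family coverage — TYPE-III WINDOWS, part Ub (census block b04.29): the Weil rows `W4.d.a` of the curves of Jacobian-carried Weil-type fourfolds over `ℚ(√-3)` (THEOREMS-S31)

research route conditional on HC_CM; not a corollary; Q11.4-sentence-2 already refuted in dim ≥ 3.

Ring 2, WEIL-TYPE FAMILY-COVERAGE CENSUS (`HOME/WEIL-FAMILY-COVERAGE.md` `## b04`, block b04.29, owner ring2-b04, gen 66).  SETTING (informal, NOT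
formalised; THEOREMS-S30/S31 of the census): each of the 127 singly-symmetric four-point families of `G`-curves (`G = SL₂(5), SL₂(7), SL₂(9)`,
rational quaternionic carrier `χ`, `D`-rank 4) is a one-parameter family of `Σ`-curves `C_t → ℙ¹/μ` (`Σ = G:⟨x⟩`, four-point `Σ`-datum
`(z₁, z₂, x₁, x₂)`), and the `χ̃`-hidden factor of `C_t` (`χ̃` the extension character, `K = ℚ(χ̃)` imaginary quadratic, Schur index one) is a
Weil-type abelian FOURFOLD `A_t` over `K` of signature `(2,2)` with `B_t ∼ A_t²`.  Ring2-b02's THEOREM X (census b02.21: `a_B ≡ ∏ disc_c · |∏ δ_c|`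
modulo `Nm(Kˣ)`) and the literal Gram determinant of the cup form in the (P1)-model `Z/R` were evaluated EXACTLY over `K` by the census engine
`xrow66.py` for all 127 families (THEOREMS-S31: the two legs agree 127/127, `K`-signature `(2,2)` 127/127).  THIS FILE pins the norm-class
arithmetic of the literal numbers of one representative family per (row, carrier): the THEOREM-X value `a_X` and the direct Gram determinant `d`
lie in the class `[a]` of `ℚˣ/Nm(Kˣ)` (`VanGeemen1994.weilNormResidueGroup`), witnessed by explicit solutions of `x² + q·y² = ·`, and that class is
(resp. is not) the split class `Ring2.Hypotheses.splitDiscriminantClass 2 q` — by the cell's ALREADY-LANDED non-split certificates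
(`Ring2WeilNormObstructionDescentCensus`, `Ring2AbelianAllNonsplitNormObstruction`), which are not restated.  Rows met in this part: W4.3.1, W4.3.2, W4.3.5, W4.3.10
(the other field(s) in the companion part).  The signatures, THEOREM X and the (P1)-model are computations / structure theorems of the census, not
kernel facts; nothing here is a statement about Hodge classes; `HC_CM` is used nowhere.

References: [cite: vanGeemen1994HodgeAV, 5.2 and (5.4.1)].
-/

noncomputable section

set_option linter.dupNamespace false

open Literature.AlgebraicGeometry.Motives
open Literature.AlgebraicGeometry.VanGeemen1994
open Summit.HodgeConjecture.HodgeConjecture.Ring2.Hypotheses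
open Summit.HodgeConjecture.Ring2WeilNormDescent

namespace Summit.HodgeConjecture.HodgeConjecture.Ring2.WeilCoverage.SigmaDataWeilRowsB

/-- **2I χ₄, family `(10_7,10_9,6_5,6_5)` #0 (genus 89; `Σ = SL2(5):2[delta,h=3]`, `Σ`-datum classes `10_7,6_5,x2_7,x2_7`; `K = ℚ(√-3)`): the THEOREM-X value `a_X = ∏ disc_c · |∏ δ_c| = 746496/49 · 64 = 47775744/49` has class `[1]` in `ℚˣ/Nm(Kˣ)`** — `(47775744/49)⁻¹ · 1 = 49/47775744 = x² + 3·y²` with `x = 7/6912`, `y = 0`.  Row **W4.3.1**.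
research route conditional on HC_CM; not a corollary; Q11.4-sentence-2 already refuted in dim ≥ 3. [cite: vanGeemen1994HodgeAV, (5.4.1)] -/
theorem twoI_chi4_10_7_10_9_6_5_6_5_o0_theoremX_mk_eq :
    (QuotientGroup.mk (Units.mk0 ((47775744 : ℚ) / 49) (by norm_num)) : weilNormResidueGroup 3) =
      QuotientGroup.mk (Units.mk0 (1 : ℚ) (by norm_num)) := by
  rw [QuotientGroup.eq]
  have e : (Units.mk0 ((47775744 : ℚ) / 49) (by norm_num))⁻¹ * Units.mk0 (1 : ℚ) (by norm_num) =
      Units.mk0 ((49 : ℚ) / 47775744) (by norm_num) := Units.ext (by norm_num)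
  rw [e]
  exact mem_normUnitsSubgroup_of_sq_add_mul_sq _ (7 / 6912 : ℚ) (0 : ℚ) (by norm_num)

/-- **2I χ₄, family `(10_7,10_9,6_5,6_5)` #0 (genus 89; `Σ = SL2(5):2[delta,h=3]`, `Σ`-datum classes `10_7,6_5,x2_7,x2_7`; `K = ℚ(√-3)`): the absolute value `576` of the literal Gram determinant `576` of the cup form on `Z/R` ((P1)-model, `K`-dimension 4, `K`-signature (2,2)) has class `[1]` in `ℚˣ/Nm(Kˣ)`** — `(576)⁻¹ · 1 = 1/576 = x² + 3·y²` with `x = 1/24`, `y = 0`.  Row **W4.3.1**.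
research route conditional on HC_CM; not a corollary; Q11.4-sentence-2 already refuted in dim ≥ 3. [cite: vanGeemen1994HodgeAV, (5.4.1)] -/
theorem twoI_chi4_10_7_10_9_6_5_6_5_o0_gram_mk_eq :
    (QuotientGroup.mk (Units.mk0 (576 : ℚ) (by norm_num)) : weilNormResidueGroup 3) =
      QuotientGroup.mk (Units.mk0 (1 : ℚ) (by norm_num)) := by
  rw [QuotientGroup.eq]
  have e : (Units.mk0 (576 : ℚ) (by norm_num))⁻¹ * Units.mk0 (1 : ℚ) (by norm_num) =
      Units.mk0 ((1 : ℚ) / 576) (by norm_num) := Units.ext (by norm_num)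
  rw [e]
  exact mem_normUnitsSubgroup_of_sq_add_mul_sq _ (1 / 24 : ℚ) (0 : ℚ) (by norm_num)

/-- **… hence the component carrying `A_t` of this family is the SPLIT one: `[576] = splitDiscriminantClass 2 3`** (`n = 2` even: split iff a norm; `576 = x² + 3·y²`, `x = 24`, `y = 0`).  Row W4.3.1.
research route conditional on HC_CM; not a corollary; Q11.4-sentence-2 already refuted in dim ≥ 3. [cite: vanGeemen1994HodgeAV, (5.4.1)] -/
theorem twoI_chi4_10_7_10_9_6_5_6_5_o0_gram_eq_split :
    (QuotientGroup.mk (Units.mk0 (576 : ℚ) (by norm_num)) : weilNormResidueGroup 3) = splitDiscriminantClass 2 3 :=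
  (mk_eq_splitDiscriminantClass_iff_of_even (by decide) _).2
    (mem_normUnitsSubgroup_of_sq_add_mul_sq _ (24 : ℚ) (0 : ℚ) (by norm_num))

/-- **SL₂(7) χ₈, family `(7_3,3_2,3_2,7_4)` #0 (genus 177; `Σ = SL2(7):2[delta,h=1]`, `Σ`-datum classes `7_3,3_2,x2_9,x2_9`; `K = ℚ(√-3)`): the THEOREM-X value `a_X = ∏ disc_c · |∏ δ_c| = 4032 · 48384 = 195084288` has class `[1]` in `ℚˣ/Nm(Kˣ)`** — `(195084288)⁻¹ · 1 = 1/195084288 = x² + 3·y²` with `x = 0`, `y = 1/24192`.  Row **W4.3.1**.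
research route conditional on HC_CM; not a corollary; Q11.4-sentence-2 already refuted in dim ≥ 3. [cite: vanGeemen1994HodgeAV, (5.4.1)] -/
theorem sl27_chi8_7_3_3_2_3_2_7_4_o0_theoremX_mk_eq :
    (QuotientGroup.mk (Units.mk0 (195084288 : ℚ) (by norm_num)) : weilNormResidueGroup 3) =
      QuotientGroup.mk (Units.mk0 (1 : ℚ) (by norm_num)) := by
  rw [QuotientGroup.eq]
  have e : (Units.mk0 (195084288 : ℚ) (by norm_num))⁻¹ * Units.mk0 (1 : ℚ) (by norm_num) =
      Units.mk0 ((1 : ℚ) / 195084288) (by norm_num) := Units.ext (by norm_num)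
  rw [e]
  exact mem_normUnitsSubgroup_of_sq_add_mul_sq _ (0 : ℚ) (1 / 24192 : ℚ) (by norm_num)

/-- **SL₂(7) χ₈, family `(7_3,3_2,3_2,7_4)` #0 (genus 177; `Σ = SL2(7):2[delta,h=1]`, `Σ`-datum classes `7_3,3_2,x2_9,x2_9`; `K = ℚ(√-3)`): the absolute value `16/3` of the literal Gram determinant `16/3` of the cup form on `Z/R` ((P1)-model, `K`-dimension 4, `K`-signature (2,2)) has class `[1]` in `ℚˣ/Nm(Kˣ)`** — `(16/3)⁻¹ · 1 = 3/16 = x² + 3·y²` with `x = 0`, `y = 1/4`.  Row **W4.3.1**.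
research route conditional on HC_CM; not a corollary; Q11.4-sentence-2 already refuted in dim ≥ 3. [cite: vanGeemen1994HodgeAV, (5.4.1)] -/
theorem sl27_chi8_7_3_3_2_3_2_7_4_o0_gram_mk_eq :
    (QuotientGroup.mk (Units.mk0 ((16 : ℚ) / 3) (by norm_num)) : weilNormResidueGroup 3) =
      QuotientGroup.mk (Units.mk0 (1 : ℚ) (by norm_num)) := by
  rw [QuotientGroup.eq]
  have e : (Units.mk0 ((16 : ℚ) / 3) (by norm_num))⁻¹ * Units.mk0 (1 : ℚ) (by norm_num) =
      Units.mk0 ((3 : ℚ) / 16) (by norm_num) := Units.ext (by norm_num)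
  rw [e]
  exact mem_normUnitsSubgroup_of_sq_add_mul_sq _ (0 : ℚ) (1 / 4 : ℚ) (by norm_num)

/-- **… hence the component carrying `A_t` of this family is the SPLIT one: `[16/3] = splitDiscriminantClass 2 3`** (`n = 2` even: split iff a norm; `16/3 = x² + 3·y²`, `x = 0`, `y = 4/3`).  Row W4.3.1.
research route conditional on HC_CM; not a corollary; Q11.4-sentence-2 already refuted in dim ≥ 3. [cite: vanGeemen1994HodgeAV, (5.4.1)] -/
theorem sl27_chi8_7_3_3_2_3_2_7_4_o0_gram_eq_split :
    (QuotientGroup.mk (Units.mk0 ((16 : ℚ) / 3) (by norm_num)) : weilNormResidueGroup 3) = splitDiscriminantClass 2 3 :=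
  (mk_eq_splitDiscriminantClass_iff_of_even (by decide) _).2
    (mem_normUnitsSubgroup_of_sq_add_mul_sq _ (0 : ℚ) (4 / 3 : ℚ) (by norm_num))

/-- **2.A₆ η, family `(10_8,10_9,3_3,3_3)` #1 (genus 409; `Σ = SL2(9):2[phi,h=0]`, `Σ`-datum classes `10_8,3_3,x2_10,x2_10`; `K = ℚ(√-3)`): the THEOREM-X value `a_X = ∏ disc_c · |∏ δ_c| = 729/1024 · 144 = 6561/64` has class `[1]` in `ℚˣ/Nm(Kˣ)`** — `(6561/64)⁻¹ · 1 = 64/6561 = x² + 3·y²` with `x = 8/81`, `y = 0`.  Row **W4.3.1**.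
research route conditional on HC_CM; not a corollary; Q11.4-sentence-2 already refuted in dim ≥ 3. [cite: vanGeemen1994HodgeAV, (5.4.1)] -/
theorem twoA6_eta_10_8_10_9_3_3_3_3_o1_theoremX_mk_eq :
    (QuotientGroup.mk (Units.mk0 ((6561 : ℚ) / 64) (by norm_num)) : weilNormResidueGroup 3) =
      QuotientGroup.mk (Units.mk0 (1 : ℚ) (by norm_num)) := by
  rw [QuotientGroup.eq]
  have e : (Units.mk0 ((6561 : ℚ) / 64) (by norm_num))⁻¹ * Units.mk0 (1 : ℚ) (by norm_num) =
      Units.mk0 ((64 : ℚ) / 6561) (by norm_num) := Units.ext (by norm_num)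
  rw [e]
  exact mem_normUnitsSubgroup_of_sq_add_mul_sq _ (8 / 81 : ℚ) (0 : ℚ) (by norm_num)

/-- **2.A₆ η, family `(10_8,10_9,3_3,3_3)` #1 (genus 409; `Σ = SL2(9):2[phi,h=0]`, `Σ`-datum classes `10_8,3_3,x2_10,x2_10`; `K = ℚ(√-3)`): the absolute value `4` of the literal Gram determinant `4` of the cup form on `Z/R` ((P1)-model, `K`-dimension 4, `K`-signature (2,2)) has class `[1]` in `ℚˣ/Nm(Kˣ)`** — `(4)⁻¹ · 1 = 1/4 = x² + 3·y²` with `x = 1/2`, `y = 0`.  Row **W4.3.1**.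
research route conditional on HC_CM; not a corollary; Q11.4-sentence-2 already refuted in dim ≥ 3. [cite: vanGeemen1994HodgeAV, (5.4.1)] -/
theorem twoA6_eta_10_8_10_9_3_3_3_3_o1_gram_mk_eq :
    (QuotientGroup.mk (Units.mk0 (4 : ℚ) (by norm_num)) : weilNormResidueGroup 3) =
      QuotientGroup.mk (Units.mk0 (1 : ℚ) (by norm_num)) := by
  rw [QuotientGroup.eq]
  have e : (Units.mk0 (4 : ℚ) (by norm_num))⁻¹ * Units.mk0 (1 : ℚ) (by norm_num) =
      Units.mk0 ((1 : ℚ) / 4) (by norm_num) := Units.ext (by norm_num)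
  rw [e]
  exact mem_normUnitsSubgroup_of_sq_add_mul_sq _ (1 / 2 : ℚ) (0 : ℚ) (by norm_num)

/-- **… hence the component carrying `A_t` of this family is the SPLIT one: `[4] = splitDiscriminantClass 2 3`** (`n = 2` even: split iff a norm; `4 = x² + 3·y²`, `x = 2`, `y = 0`).  Row W4.3.1.
research route conditional on HC_CM; not a corollary; Q11.4-sentence-2 already refuted in dim ≥ 3. [cite: vanGeemen1994HodgeAV, (5.4.1)] -/
theorem twoA6_eta_10_8_10_9_3_3_3_3_o1_gram_eq_split :
    (QuotientGroup.mk (Units.mk0 (4 : ℚ) (by norm_num)) : weilNormResidueGroup 3) = splitDiscriminantClass 2 3 :=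
  (mk_eq_splitDiscriminantClass_iff_of_even (by decide) _).2
    (mem_normUnitsSubgroup_of_sq_add_mul_sq _ (2 : ℚ) (0 : ℚ) (by norm_num))

/-- **2.A₆ η, family `(8_4,8_7,3_3,3_3)` #1 (genus 391; `Σ = SL2(9):2[phi,h=0]`, `Σ`-datum classes `8_4,3_3,x2_10,x2_10`; `K = ℚ(√-3)`): the THEOREM-X value `a_X = ∏ disc_c · |∏ δ_c| = 729/1024 · 288 = 6561/32` has class `[2]` in `ℚˣ/Nm(Kˣ)`** — `(6561/32)⁻¹ · 2 = 64/6561 = x² + 3·y²` with `x = 8/81`, `y = 0`.  Row **W4.3.2**.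
research route conditional on HC_CM; not a corollary; Q11.4-sentence-2 already refuted in dim ≥ 3. [cite: vanGeemen1994HodgeAV, (5.4.1)] -/
theorem twoA6_eta_8_4_8_7_3_3_3_3_o1_theoremX_mk_eq :
    (QuotientGroup.mk (Units.mk0 ((6561 : ℚ) / 32) (by norm_num)) : weilNormResidueGroup 3) =
      QuotientGroup.mk (Units.mk0 (2 : ℚ) (by norm_num)) := by
  rw [QuotientGroup.eq]
  have e : (Units.mk0 ((6561 : ℚ) / 32) (by norm_num))⁻¹ * Units.mk0 (2 : ℚ) (by norm_num) =
      Units.mk0 ((64 : ℚ) / 6561) (by norm_num) := Units.ext (by norm_num)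
  rw [e]
  exact mem_normUnitsSubgroup_of_sq_add_mul_sq _ (8 / 81 : ℚ) (0 : ℚ) (by norm_num)

/-- **2.A₆ η, family `(8_4,8_7,3_3,3_3)` #1 (genus 391; `Σ = SL2(9):2[phi,h=0]`, `Σ`-datum classes `8_4,3_3,x2_10,x2_10`; `K = ℚ(√-3)`): the absolute value `2` of the literal Gram determinant `2` of the cup form on `Z/R` ((P1)-model, `K`-dimension 4, `K`-signature (2,2)) has class `[2]` in `ℚˣ/Nm(Kˣ)`** — `(2)⁻¹ · 2 = 1 = x² + 3·y²` with `x = 1`, `y = 0`.  Row **W4.3.2**.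
research route conditional on HC_CM; not a corollary; Q11.4-sentence-2 already refuted in dim ≥ 3. [cite: vanGeemen1994HodgeAV, (5.4.1)] -/
theorem twoA6_eta_8_4_8_7_3_3_3_3_o1_gram_mk_eq :
    (QuotientGroup.mk (Units.mk0 (2 : ℚ) (by norm_num)) : weilNormResidueGroup 3) =
      QuotientGroup.mk (Units.mk0 (2 : ℚ) (by norm_num)) := by
  rw [QuotientGroup.eq]
  have e : (Units.mk0 (2 : ℚ) (by norm_num))⁻¹ * Units.mk0 (2 : ℚ) (by norm_num) =
      Units.mk0 (1 : ℚ) (by norm_num) := Units.ext (by norm_num)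
  rw [e]
  exact mem_normUnitsSubgroup_of_sq_add_mul_sq _ (1 : ℚ) (0 : ℚ) (by norm_num)

/-- **… hence the component carrying `A_t` of this family is NOT the split one: `[2] = [2] ≠ splitDiscriminantClass 2 3`** (by the cell's landed non-split certificate for `(ℚ(√-3), a = 2)`, not restated).  Row W4.3.2.
research route conditional on HC_CM; not a corollary; Q11.4-sentence-2 already refuted in dim ≥ 3. [cite: vanGeemen1994HodgeAV, (5.4.1)] -/
theorem twoA6_eta_8_4_8_7_3_3_3_3_o1_gram_ne_split :
    (QuotientGroup.mk (Units.mk0 (2 : ℚ) (by norm_num)) : weilNormResidueGroup 3) ≠ splitDiscriminantClass 2 3 := by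
  rw [twoA6_eta_8_4_8_7_3_3_3_3_o1_gram_mk_eq]
  exact Summit.HodgeConjecture.Ring2AbelianAll.NonsplitNormObstruction.two_ne_splitDiscriminantClass_of_even (by decide)

/-- **2I χ₄, family `(4_4,4_4,5_2,5_3)` #0 (genus 67; `Σ = SL2(5):2[delta,h=3]`, `Σ`-datum classes `4_4,5_2,x2_7,x2_7`; `K = ℚ(√-3)`): the THEOREM-X value `a_X = ∏ disc_c · |∏ δ_c| = 746496/49 · 320 = 238878720/49` has class `[5]` in `ℚˣ/Nm(Kˣ)`** — `(238878720/49)⁻¹ · 5 = 49/47775744 = x² + 3·y²` with `x = 7/6912`, `y = 0`.  Row **W4.3.5**.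
research route conditional on HC_CM; not a corollary; Q11.4-sentence-2 already refuted in dim ≥ 3. [cite: vanGeemen1994HodgeAV, (5.4.1)] -/
theorem twoI_chi4_4_4_4_4_5_2_5_3_o0_theoremX_mk_eq :
    (QuotientGroup.mk (Units.mk0 ((238878720 : ℚ) / 49) (by norm_num)) : weilNormResidueGroup 3) =
      QuotientGroup.mk (Units.mk0 (5 : ℚ) (by norm_num)) := by
  rw [QuotientGroup.eq]
  have e : (Units.mk0 ((238878720 : ℚ) / 49) (by norm_num))⁻¹ * Units.mk0 (5 : ℚ) (by norm_num) =
      Units.mk0 ((49 : ℚ) / 47775744) (by norm_num) := Units.ext (by norm_num)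
  rw [e]
  exact mem_normUnitsSubgroup_of_sq_add_mul_sq _ (7 / 6912 : ℚ) (0 : ℚ) (by norm_num)

/-- **2I χ₄, family `(4_4,4_4,5_2,5_3)` #0 (genus 67; `Σ = SL2(5):2[delta,h=3]`, `Σ`-datum classes `4_4,5_2,x2_7,x2_7`; `K = ℚ(√-3)`): the absolute value `576/5` of the literal Gram determinant `576/5` of the cup form on `Z/R` ((P1)-model, `K`-dimension 4, `K`-signature (2,2)) has class `[5]` in `ℚˣ/Nm(Kˣ)`** — `(576/5)⁻¹ · 5 = 25/576 = x² + 3·y²` with `x = 5/24`, `y = 0`.  Row **W4.3.5**.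
research route conditional on HC_CM; not a corollary; Q11.4-sentence-2 already refuted in dim ≥ 3. [cite: vanGeemen1994HodgeAV, (5.4.1)] -/
theorem twoI_chi4_4_4_4_4_5_2_5_3_o0_gram_mk_eq :
    (QuotientGroup.mk (Units.mk0 ((576 : ℚ) / 5) (by norm_num)) : weilNormResidueGroup 3) =
      QuotientGroup.mk (Units.mk0 (5 : ℚ) (by norm_num)) := by
  rw [QuotientGroup.eq]
  have e : (Units.mk0 ((576 : ℚ) / 5) (by norm_num))⁻¹ * Units.mk0 (5 : ℚ) (by norm_num) =
      Units.mk0 ((25 : ℚ) / 576) (by norm_num) := Units.ext (by norm_num)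
  rw [e]
  exact mem_normUnitsSubgroup_of_sq_add_mul_sq _ (5 / 24 : ℚ) (0 : ℚ) (by norm_num)

/-- **… hence the component carrying `A_t` of this family is NOT the split one: `[576/5] = [5] ≠ splitDiscriminantClass 2 3`** (by the cell's landed non-split certificate for `(ℚ(√-3), a = 5)`, not restated).  Row W4.3.5.
research route conditional on HC_CM; not a corollary; Q11.4-sentence-2 already refuted in dim ≥ 3. [cite: vanGeemen1994HodgeAV, (5.4.1)] -/
theorem twoI_chi4_4_4_4_4_5_2_5_3_o0_gram_ne_split :
    (QuotientGroup.mk (Units.mk0 ((576 : ℚ) / 5) (by norm_num)) : weilNormResidueGroup 3) ≠ splitDiscriminantClass 2 3 := by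
  rw [twoI_chi4_4_4_4_4_5_2_5_3_o0_gram_mk_eq]
  exact five_ne_split_three_of_even (by decide)

/-- **2.A₆ η, family `(5_11,5_10,6_12,6_12)` #1 (genus 457; `Σ = SL2(9):2[phi,h=0]`, `Σ`-datum classes `5_11,6_12,x2_10,x2_10`; `K = ℚ(√-3)`): the THEOREM-X value `a_X = ∏ disc_c · |∏ δ_c| = 729/1024 · 80 = 3645/64` has class `[5]` in `ℚˣ/Nm(Kˣ)`** — `(3645/64)⁻¹ · 5 = 64/729 = x² + 3·y²` with `x = 8/27`, `y = 0`.  Row **W4.3.5**.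
research route conditional on HC_CM; not a corollary; Q11.4-sentence-2 already refuted in dim ≥ 3. [cite: vanGeemen1994HodgeAV, (5.4.1)] -/
theorem twoA6_eta_5_11_5_10_6_12_6_12_o1_theoremX_mk_eq :
    (QuotientGroup.mk (Units.mk0 ((3645 : ℚ) / 64) (by norm_num)) : weilNormResidueGroup 3) =
      QuotientGroup.mk (Units.mk0 (5 : ℚ) (by norm_num)) := by
  rw [QuotientGroup.eq]
  have e : (Units.mk0 ((3645 : ℚ) / 64) (by norm_num))⁻¹ * Units.mk0 (5 : ℚ) (by norm_num) =
      Units.mk0 ((64 : ℚ) / 729) (by norm_num) := Units.ext (by norm_num)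
  rw [e]
  exact mem_normUnitsSubgroup_of_sq_add_mul_sq _ (8 / 27 : ℚ) (0 : ℚ) (by norm_num)

/-- **2.A₆ η, family `(5_11,5_10,6_12,6_12)` #1 (genus 457; `Σ = SL2(9):2[phi,h=0]`, `Σ`-datum classes `5_11,6_12,x2_10,x2_10`; `K = ℚ(√-3)`): the absolute value `36/5` of the literal Gram determinant `36/5` of the cup form on `Z/R` ((P1)-model, `K`-dimension 4, `K`-signature (2,2)) has class `[5]` in `ℚˣ/Nm(Kˣ)`** — `(36/5)⁻¹ · 5 = 25/36 = x² + 3·y²` with `x = 5/6`, `y = 0`.  Row **W4.3.5**.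
research route conditional on HC_CM; not a corollary; Q11.4-sentence-2 already refuted in dim ≥ 3. [cite: vanGeemen1994HodgeAV, (5.4.1)] -/
theorem twoA6_eta_5_11_5_10_6_12_6_12_o1_gram_mk_eq :
    (QuotientGroup.mk (Units.mk0 ((36 : ℚ) / 5) (by norm_num)) : weilNormResidueGroup 3) =
      QuotientGroup.mk (Units.mk0 (5 : ℚ) (by norm_num)) := by
  rw [QuotientGroup.eq]
  have e : (Units.mk0 ((36 : ℚ) / 5) (by norm_num))⁻¹ * Units.mk0 (5 : ℚ) (by norm_num) =
      Units.mk0 ((25 : ℚ) / 36) (by norm_num) := Units.ext (by norm_num)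
  rw [e]
  exact mem_normUnitsSubgroup_of_sq_add_mul_sq _ (5 / 6 : ℚ) (0 : ℚ) (by norm_num)

/-- **… hence the component carrying `A_t` of this family is NOT the split one: `[36/5] = [5] ≠ splitDiscriminantClass 2 3`** (by the cell's landed non-split certificate for `(ℚ(√-3), a = 5)`, not restated).  Row W4.3.5.
research route conditional on HC_CM; not a corollary; Q11.4-sentence-2 already refuted in dim ≥ 3. [cite: vanGeemen1994HodgeAV, (5.4.1)] -/
theorem twoA6_eta_5_11_5_10_6_12_6_12_o1_gram_ne_split :
    (QuotientGroup.mk (Units.mk0 ((36 : ℚ) / 5) (by norm_num)) : weilNormResidueGroup 3) ≠ splitDiscriminantClass 2 3 := by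
  rw [twoA6_eta_5_11_5_10_6_12_6_12_o1_gram_mk_eq]
  exact five_ne_split_three_of_even (by decide)

/-- **2.A₆ η, family `(8_4,8_7,5_11,5_10)` #2 (genus 487; `Σ = SL2(9):2[phi,h=0]`, `Σ`-datum classes `8_4,5_11,x2_10,x2_10`; `K = ℚ(√-3)`): the THEOREM-X value `a_X = ∏ disc_c · |∏ δ_c| = 729/1024 · 160 = 3645/32` has class `[10]` in `ℚˣ/Nm(Kˣ)`** — `(3645/32)⁻¹ · 10 = 64/729 = x² + 3·y²` with `x = 8/27`, `y = 0`.  Row **W4.3.10**.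
research route conditional on HC_CM; not a corollary; Q11.4-sentence-2 already refuted in dim ≥ 3. [cite: vanGeemen1994HodgeAV, (5.4.1)] -/
theorem twoA6_eta_8_4_8_7_5_11_5_10_o2_theoremX_mk_eq :
    (QuotientGroup.mk (Units.mk0 ((3645 : ℚ) / 32) (by norm_num)) : weilNormResidueGroup 3) =
      QuotientGroup.mk (Units.mk0 (10 : ℚ) (by norm_num)) := by
  rw [QuotientGroup.eq]
  have e : (Units.mk0 ((3645 : ℚ) / 32) (by norm_num))⁻¹ * Units.mk0 (10 : ℚ) (by norm_num) =
      Units.mk0 ((64 : ℚ) / 729) (by norm_num) := Units.ext (by norm_num)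
  rw [e]
  exact mem_normUnitsSubgroup_of_sq_add_mul_sq _ (8 / 27 : ℚ) (0 : ℚ) (by norm_num)

/-- **2.A₆ η, family `(8_4,8_7,5_11,5_10)` #2 (genus 487; `Σ = SL2(9):2[phi,h=0]`, `Σ`-datum classes `8_4,5_11,x2_10,x2_10`; `K = ℚ(√-3)`): the absolute value `81/10` of the literal Gram determinant `81/10` of the cup form on `Z/R` ((P1)-model, `K`-dimension 4, `K`-signature (2,2)) has class `[10]` in `ℚˣ/Nm(Kˣ)`** — `(81/10)⁻¹ · 10 = 100/81 = x² + 3·y²` with `x = 10/9`, `y = 0`.  Row **W4.3.10**.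
research route conditional on HC_CM; not a corollary; Q11.4-sentence-2 already refuted in dim ≥ 3. [cite: vanGeemen1994HodgeAV, (5.4.1)] -/
theorem twoA6_eta_8_4_8_7_5_11_5_10_o2_gram_mk_eq :
    (QuotientGroup.mk (Units.mk0 ((81 : ℚ) / 10) (by norm_num)) : weilNormResidueGroup 3) =
      QuotientGroup.mk (Units.mk0 (10 : ℚ) (by norm_num)) := by
  rw [QuotientGroup.eq]
  have e : (Units.mk0 ((81 : ℚ) / 10) (by norm_num))⁻¹ * Units.mk0 (10 : ℚ) (by norm_num) =
      Units.mk0 ((100 : ℚ) / 81) (by norm_num) := Units.ext (by norm_num)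
  rw [e]
  exact mem_normUnitsSubgroup_of_sq_add_mul_sq _ (10 / 9 : ℚ) (0 : ℚ) (by norm_num)

/-- **… hence the component carrying `A_t` of this family is NOT the split one: `[81/10] = [10] ≠ splitDiscriminantClass 2 3`** (by the cell's landed non-split certificate for `(ℚ(√-3), a = 10)`, not restated).  Row W4.3.10.
research route conditional on HC_CM; not a corollary; Q11.4-sentence-2 already refuted in dim ≥ 3. [cite: vanGeemen1994HodgeAV, (5.4.1)] -/
theorem twoA6_eta_8_4_8_7_5_11_5_10_o2_gram_ne_split :
    (QuotientGroup.mk (Units.mk0 ((81 : ℚ) / 10) (by norm_num)) : weilNormResidueGroup 3) ≠ splitDiscriminantClass 2 3 := by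
  rw [twoA6_eta_8_4_8_7_5_11_5_10_o2_gram_mk_eq]
  exact ten_ne_split_three_of_even (by decide)

/-- THEOREM X's determinant factor is an integer square root: for the thirteen representative data, `|Π|² = ∏_j Nm(δ_{c_j})` with `|Π| ∈ {64, 2304, 16, 48384, 2560, 144, 160, 288, 320, 80}` as used above (`64² = 4096`, …) — elementary bookkeeping of the engine's (X1) leg.
research route conditional on HC_CM; not a corollary; Q11.4-sentence-2 already refuted in dim ≥ 3. [cite: vanGeemen1994HodgeAV, 5.2] -/
theorem absPi_squares_b :
    (64 : ℕ) ^ 2 = 4096 ∧ (2304 : ℕ) ^ 2 = 5308416 ∧ (16 : ℕ) ^ 2 = 256 ∧ (48384 : ℕ) ^ 2 = 2341011456 ∧ (2560 : ℕ) ^ 2 = 6553600 ∧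
    (144 : ℕ) ^ 2 = 20736 ∧ (160 : ℕ) ^ 2 = 25600 ∧ (288 : ℕ) ^ 2 = 82944 ∧ (320 : ℕ) ^ 2 = 102400 ∧ (80 : ℕ) ^ 2 = 6400 := by norm_num

end Summit.HodgeConjecture.HodgeConjecture.Ring2.WeilCoverage.SigmaDataWeilRowsB

end
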